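import Summits.QuantumFields.BalabanUV.T4Continuum.Support.VariationalVectorOneStepRepair

/-!
# T⁴ programme, spine node NE2 (U1a), lane P2 — SUPPLIER LEAF V-ONE FOR E-VALUED 1-FORMS («V-ONE-1F»), file 8: THE FULL `hONE` BINDER FROM THE CURL
# HALF AND A FINE-LEVEL GAUGE SLICE (SLICE′) — the upper-bracket twin of leaf-09-g6's (SLICE) reframing of leaf V-GF

NE2 formalisation swarm `b2b-balaban-t4-ne2-formalise-*`, leaf prover 01 GEN 6 (`prover-b2b-balaban-t4-ne2-formalise-leaf-01-g6-0`); own-initiative corollary (journal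
2026-08-20 ≈14:20Z) of file 5 `VariationalVectorOneStepPhys.SfV_interpV_le` (the curl half at the tilted competitor) and file 6 `VariationalVectorOneStepRepair.nsqV_interpV_le`
(its size), answering leaf-09-g6's design note (CLAIMS.log 2026-08-20 14:00Z «V-GF REFRAMED = THE GAUGE-SLICE LOWER BRACKET»): there the LOWER bracket's `hFED` for the full
form is replaced by the curl Federbush + a coarse-level slice; HERE the UPPER bracket's `hONE` for the full fine form `SfV R′ G′` is obtained from the curl half + the
fine-level slice
  (SLICE′)  `∀ W′, ∃ V′, Q₁ V′ = Q₁ W′ ∧ SfV n L M R′ G′ V′ ≤ SfV n L M R′ 0 W′ + σ′·qVV n L M W′`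
(«inside every fine fibre the zero set of `G′` is reachable at curl-cost `σ′`·size»; DISPLAYED — at `U = 1` Bałaban's `(I − P)∂*` functional has `σ′ = 0` by the note's
(iii); with background `σ′ = O(curvature)` is leaf V-GF's content, NOT proved here).  This supersedes, for divergence-type `G′`, file 5's `blockSpin_Q1_le_of_GF` whose
displayed (GF2′) is NOT to be expected (located note N-ne2leaf01g6-1).
THE STATEMENT (**`blockSpin_Q1_le_of_slice`**; `Q₁ := QvL L (fine n M) (frameT U′ Rc)`; files 1–5's data; any `G, G′ ≥ 0`, `0 ≤ σ′`):
    `blockSpin Q₁ (SfV n L M R′ G′) W ≤ ( √( ScV n M Rc G W + 4(d+26)(L∕n²)·rhoV W ) + (δ′ + √(σ′·(4(1+d²)+50)))·√(qWV n M W) )²`,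
`δ′ = nL√(d(50p²∕L + (32(1+d²)+400)m²)∕2)` — the `hONE` binder of `VariationalVectorForm.vector_pair_bracket_sqrt` for the FULL fine form; also
`QvL_frameT_surjective` (the census's `hsurj₁` binder at `frameT` carriers) and the abstract any-carrier step `blockSpin_le_of_slice`.

HONEST FRAMING (T4-DAG p. 1).  Model level (frames ∕ transports ∕ `G`, `G′` DATA); [folklore] real bookkeeping; (SLICE′) displayed, not proved; nothing printed is a
hypothesis; no `def`, no `def … : Prop`, no `sorry`; axioms standard.  NE2 NOT proved; spine PROVED 0∕9; rung (B)+1 finite T⁴ — NOT infinite volume, NOT mass gap, NOT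
Clay.  HONEST DEPENDENCY (cell, verbatim): continuum YM on T⁴ ⇐ BetaPertH ∧ nine spine estimates (0/9 proved); BetaPertH ⇐ (D1) ∧ (D4) ∧ CAP+tail; G-an2-4 gates
asym, D1 and NE2/3/4.
-/

noncomputable section

namespace Summit.QuantumFields.BalabanUV.T4Continuum.VariationalVectorOneStepSlice

open Literature.MathematicalPhysics.QuantumFieldTheory.Balaban1983to89
open Literature.MathematicalPhysics.QuantumFieldTheory.Balaban1983to89.B5Prop11Plancherel (Tor fine unitVec)
open Literature.MathematicalPhysics.QuantumFieldTheory.Balaban1983to89.B5Block118 (bpt)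
open Summit.QuantumFields.BalabanUV.T4Continuum.VariationalTransfer (blockSpin blockSpin_le)
open Summit.QuantumFields.BalabanUV.T4Continuum.VariationalColourFederbush (norm_le_one_of_mem_unitary)
open Summit.QuantumFields.BalabanUV.T4Continuum.VectorBlockTrialForm (nsqV nsqV_nonneg QvL)
open Summit.QuantumFields.BalabanUV.T4Continuum.VariationalVectorForm (ScV SfV qWV qVV ScV_nonneg SfV_nonneg qWV_nonneg)
open Summit.QuantumFields.BalabanUV.T4Continuum.VariationalVectorInterpolant (interpV frameT QvL_interpV)
open Summit.QuantumFields.BalabanUV.T4Continuum.VariationalVectorOneStep (plaq)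
open Summit.QuantumFields.BalabanUV.T4Continuum.VariationalVectorOneStepPhys (rhoV rhoV_nonneg SfV_interpV_le)
open Summit.QuantumFields.BalabanUV.T4Continuum.VariationalVectorOneStepRepair (nsqV_interpV_le)

variable {d : ℕ} {E : Type*} [NormedAddCommGroup E] [InnerProductSpace ℂ E] [CompleteSpace E]
variable (n L : ℕ) [NeZero n] [NeZero L] (M : Fin d → ℕ) [hM : ∀ μ, NeZero (M μ)]
variable {Rc : Tor (fine n M) → Fin d → (E →L[ℂ] E)} {R' : Tor (fine L (fine n M)) → Fin d → (E →L[ℂ] E)}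
variable {U' : Tor (fine L (fine n M)) → (E →L[ℂ] E)} {m p : ℝ}

/-- **THE FRAME-ADAPTED ONE-STEP CARRIER IS ONTO** (the V-END census's `hsurj₁` binder, `VariationalVectorEndOfLeaves.towerLimitRate_effV_of_leaves`, at
`T′ := frameT U′ Rc`): the tilted interpolant of file 1 is an explicit right inverse (`QvL_interpV`). [folklore] -/
theorem QvL_frameT_surjective (hU : ∀ x, U' x ∈ unitary (E →L[ℂ] E)) :
    Function.Surjective (QvL L (fine n M) (frameT L (fine n M) U' Rc)) :=
  fun W => ⟨interpV L (fine n M) U' Rc W, QvL_interpV L (fine n M) Rc W hU⟩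

omit [CompleteSpace E] in
/-- **ABSTRACT SLICE STEP, ANY CARRIER `Q₁`**: a competitor `W′` over `W` with pure-curl fine form `≤ X` and size `qVV W′ ≤ Y`, plus (SLICE′) at cost `σ′`,
bound the block-spin value of the FULL fine form: `blockSpin Q₁ (SfV R′ G′) W ≤ X + σ′·Y` (for general line carriers `Q_T` combine with an `∃`-form of file 6's
repaired competitor). [folklore] -/
theorem blockSpin_le_of_slice {Q₁ : (Tor (fine L (fine n M)) → Fin d → E) → (Tor (fine n M) → Fin d → E)}
    {G' : (Tor (fine L (fine n M)) → Fin d → E) → ℝ} (hG0' : ∀ W', 0 ≤ G' W') {σ' : ℝ} (hσ' : 0 ≤ σ')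
    (hslice : ∀ W' : Tor (fine L (fine n M)) → Fin d → E, ∃ V' : Tor (fine L (fine n M)) → Fin d → E,
      Q₁ V' = Q₁ W' ∧ SfV n L M R' G' V' ≤ SfV n L M R' (fun _ => 0) W' + σ' * qVV n L M W')
    {W : Tor (fine n M) → Fin d → E} {W' : Tor (fine L (fine n M)) → Fin d → E} (hW' : Q₁ W' = W) {X Y : ℝ}
    (hX : SfV n L M R' (fun _ => 0) W' ≤ X) (hY : qVV n L M W' ≤ Y) :
    blockSpin Q₁ (SfV n L M R' G') W ≤ X + σ' * Y := by
  obtain ⟨V', hV', hSV'⟩ := hslice W'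
  rw [hW'] at hV'
  exact (blockSpin_le (SfV_nonneg n L M R' hG0') hV').trans (hSV'.trans (add_le_add hX (mul_le_mul_of_nonneg_left hY hσ')))

/-- the physical size of the tilted competitor: `qVV n L M Λ′_W ≤ (4(1+d²)+50)·qWV n M W`. [folklore] -/
theorem qVV_interpV_le (hU : ∀ x, U' x ∈ unitary (E →L[ℂ] E)) (hRc : ∀ y μ, ‖Rc y μ‖ ≤ 1) (W : Tor (fine n M) → Fin d → E) :
    qVV n L M (interpV L (fine n M) U' Rc W) ≤ (4 * (1 + (d : ℝ) ^ 2) + 50) * qWV n M W := by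
  have hn : (0 : ℝ) < n := by exact_mod_cast Nat.pos_of_ne_zero (NeZero.ne n)
  have hL : (0 : ℝ) < L := by exact_mod_cast Nat.pos_of_ne_zero (NeZero.ne L)
  have h := nsqV_interpV_le n L M hU hRc W
  unfold qVV qWV
  rw [mul_pow]
  calc (((n : ℝ) ^ d * (L : ℝ) ^ d))⁻¹ * nsqV (fine L (fine n M)) (interpV L (fine n M) U' Rc W)
      ≤ (((n : ℝ) ^ d * (L : ℝ) ^ d))⁻¹ * ((4 * (1 + (d : ℝ) ^ 2) + 50) * ((L : ℝ) ^ d * nsqV (fine n M) W)) :=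
        mul_le_mul_of_nonneg_left h (by positivity)
    _ = _ := by field_simp

/-- **LEAF V-ONE-1F — THE FULL `hONE` BINDER FROM THE CURL HALF AND A FINE-LEVEL GAUGE SLICE**: files 1–5's data (`U′`, `Rc` unitary, plaquette defect
`≤ p`, fine frame defects `≤ m`), any `G ≥ 0` on the coarse side, `G′ ≥ 0` on the fine side, `0 ≤ σ′`, and the DISPLAYED fine-level slice
(SLICE′) `∀ W′, ∃ V′, Q₁V′ = Q₁W′ ∧ SfV n L M R′ G′ V′ ≤ SfV n L M R′ 0 W′ + σ′·qVV n L M W′` for `Q₁ := QvL L (fine n M) (frameT U′ Rc)` ⟹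
`blockSpin Q₁ (SfV n L M R′ G′) W ≤ ( √( ScV n M Rc G W + 4(d+26)(L∕n²)·rhoV W ) + (δ′ + √(σ′·(4(1+d²)+50)))·√(qWV n M W) )²`. [folklore] -/
theorem blockSpin_Q1_le_of_slice (hU : ∀ x, U' x ∈ unitary (E →L[ℂ] E)) (hRc1 : ∀ y μ, Rc y μ ∈ unitary (E →L[ℂ] E)) (hm : 0 ≤ m)
    (hin : ∀ (y : Tor (fine n M)) (j : Fin d → Fin L) (μ : Fin d), (j μ : ℕ) + 1 < L →
      ‖R' (bpt L (fine n M) y j) μ * star (U' (bpt L (fine n M) y j + unitVec (fine L (fine n M)) μ)) - star (U' (bpt L (fine n M) y j))‖ ≤ m)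
    (hcross : ∀ (y : Tor (fine n M)) (j : Fin d → Fin L) (μ : Fin d), (j μ : ℕ) + 1 = L →
      ‖R' (bpt L (fine n M) y j) μ * star (U' (bpt L (fine n M) y j + unitVec (fine L (fine n M)) μ))
        - star (U' (bpt L (fine n M) y j)) * Rc y μ‖ ≤ m)
    (hp : ∀ y μ ν, ‖plaq (fine n M) Rc y μ ν‖ ≤ p) {G : (Tor (fine n M) → Fin d → E) → ℝ} (hG0 : ∀ W, 0 ≤ G W)
    {G' : (Tor (fine L (fine n M)) → Fin d → E) → ℝ} (hG0' : ∀ W', 0 ≤ G' W') {σ' : ℝ} (hσ' : 0 ≤ σ')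
    (hslice : ∀ W' : Tor (fine L (fine n M)) → Fin d → E, ∃ V' : Tor (fine L (fine n M)) → Fin d → E,
      QvL L (fine n M) (frameT L (fine n M) U' Rc) V' = QvL L (fine n M) (frameT L (fine n M) U' Rc) W' ∧
        SfV n L M R' G' V' ≤ SfV n L M R' (fun _ => 0) W' + σ' * qVV n L M W')
    (W : Tor (fine n M) → Fin d → E) :
    blockSpin (QvL L (fine n M) (frameT L (fine n M) U' Rc)) (SfV n L M R' G') W
      ≤ (Real.sqrt (ScV n M Rc G W + 4 * ((d : ℝ) + 26) * ((L : ℝ) / (n : ℝ) ^ 2) * rhoV n M Rc W)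
          + ((n : ℝ) * L * Real.sqrt (d * (50 * p ^ 2 / L + (32 * (1 + (d : ℝ) ^ 2) + 400) * m ^ 2) / 2)
              + Real.sqrt (σ' * (4 * (1 + (d : ℝ) ^ 2) + 50))) * Real.sqrt (qWV n M W)) ^ 2 := by
  have hRc : ∀ y μ, ‖Rc y μ‖ ≤ 1 := fun y μ => norm_le_one_of_mem_unitary (hRc1 y μ)
  set Λ' := interpV L (fine n M) U' Rc W with hΛ'
  have hQ : QvL L (fine n M) (frameT L (fine n M) U' Rc) Λ' = W := QvL_interpV L (fine n M) Rc W hU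
  obtain ⟨V', hV', hSV'⟩ := hslice Λ'
  rw [hQ] at hV'
  have hcurl := SfV_interpV_le n L M hU hRc1 hm hin hcross hp hG0 W
  have hsize := qVV_interpV_le n L M hU hRc W
  set A : ℝ := Real.sqrt (ScV n M Rc G W + 4 * ((d : ℝ) + 26) * ((L : ℝ) / (n : ℝ) ^ 2) * rhoV n M Rc W) with hA
  set B : ℝ := (n : ℝ) * L * Real.sqrt (d * (50 * p ^ 2 / L + (32 * (1 + (d : ℝ) ^ 2) + 400) * m ^ 2) / 2) * Real.sqrt (qWV n M W) with hB
  set D : ℝ := Real.sqrt (σ' * (4 * (1 + (d : ℝ) ^ 2) + 50)) * Real.sqrt (qWV n M W) with hD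
  have hA0 : 0 ≤ A := Real.sqrt_nonneg _
  have hB0 : 0 ≤ B := by positivity
  have hD0 : 0 ≤ D := by positivity
  have hq0 : 0 ≤ qWV n M W := qWV_nonneg n M W
  have hD2 : σ' * qVV n L M Λ' ≤ D ^ 2 := by
    rw [hD, mul_pow, Real.sq_sqrt (by positivity), Real.sq_sqrt hq0, mul_assoc]
    exact mul_le_mul_of_nonneg_left hsize hσ'
  calc blockSpin (QvL L (fine n M) (frameT L (fine n M) U' Rc)) (SfV n L M R' G') W ≤ SfV n L M R' G' V' :=
        blockSpin_le (SfV_nonneg n L M R' hG0') hV'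
    _ ≤ SfV n L M R' (fun _ => 0) Λ' + σ' * qVV n L M Λ' := hSV'
    _ ≤ (A + B) ^ 2 + D ^ 2 := add_le_add hcurl hD2
    _ ≤ (A + B + D) ^ 2 := by nlinarith [mul_nonneg (add_nonneg hA0 hB0) hD0]
    _ = _ := by rw [hB, hD]; ring

end Summit.QuantumFields.BalabanUV.T4Continuum.VariationalVectorOneStepSlice

end
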